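import Mathlib
import HarnessLib
import Summits.QuantumFields.QCD.Theorems.ExtinctionBuildsQCD.Negative.ChiralInertia

/-!
# Co-factorisation of weight and index through one Schur complement (stub S3)

Pure linear algebra consumed by the lattice stub of line `Sketch` (crux idea
`wall-conditioned-cell-spread`, crux `WindowExtinction` = SD⁺, stmt-QuantumFields-18063): conditioning
lattice QCD on a grid of walls puts the Hermitian Wilson operator in block form `H = [[A, B], [Bᴴ, D]]`
(cells / walls), and ONE Schur complement `S = A − B D⁻¹ Bᴴ` of the invertible Hermitian wall block `D`
carries both

* the phase-quenched weight, `‖det H‖ = ‖det D‖ · ‖det S‖` (Mathlib `Matrix.det_fromBlocks₂₂`), and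
* the index, `n₋(H) = n₋(D) + n₋(S)` (Haynsworth inertia additivity, 1968), where `n₋(M)` is written
  inline as `M.charpoly.roots.countP (fun z => z.re < 0)`.

The inertia half is adapted from the tree file
`Summits/QuantumFields/QCD/Theorems/SpectralDefectExtinctionTipPricingInertiaHaynsworth.lean` (which cannot
be imported here): the LDU congruence `H = Pᴴ (S ⊕ D) P` with `P = [[1, 0], [D⁻¹Bᴴ, 1]]` block
unitriangular, Sylvester's law of inertia in counting form (`n₋` is a congruence invariant, from the tree's
one-directional bound `card_le_card_eigenvalues_of_form_pos` of `ChiralInertia`), and additivity of `n₋`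
over a two-block block-diagonal matrix (`Matrix.charpoly_fromBlocks_zero₁₂`, `Polynomial.roots_mul`).
Reference: Horn–Johnson, *Matrix Analysis*, Thm. 4.5.8 and §7.7 (Haynsworth).
-/

namespace Summit.QuantumFields.QCD.Cruxes.WindowExtinction.WallConditionedCellSpread

open Matrix Polynomial
open scoped Matrix BigOperators
open Summit.QuantumFields.QCD.Theorems.ExtinctionBuildsQCD.Negative

-- adapted from Summits/QuantumFields/QCD/Theorems/SpectralDefectExtinctionTipPricingInertiaHaynsworth.lean
-- (namespace `…Cruxes.TipPricing.ModularTemplate`), with `negRootCount M` replaced by the inline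
-- `M.charpoly.roots.countP (fun z => z.re < 0)` and `extendByZero` by `Function.ExtendByZero.linearMap`.

/-- **Weight half.** For an invertible corner `D`, `‖det [[A, B], [Bᴴ, D]]‖ = ‖det D‖ · ‖det (A − B D⁻¹ Bᴴ)‖`
(Schur's determinant formula, Mathlib `Matrix.det_fromBlocks₂₂`, and multiplicativity of the norm). -/
theorem coFactorisation_norm_det {m n : Type*} [Fintype m] [Fintype n] [DecidableEq m] [DecidableEq n]
    (A : Matrix m m ℂ) (B : Matrix m n ℂ) (D : Matrix n n ℂ) (hDdet : D.det ≠ 0) :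
    ‖(Matrix.fromBlocks A B Bᴴ D).det‖ = ‖D.det‖ * ‖(A - B * D⁻¹ * Bᴴ).det‖ := by
  letI : Invertible D := Matrix.invertibleOfIsUnitDet D (isUnit_iff_ne_zero.mpr hDdet)
  rw [Matrix.det_fromBlocks₂₂, Matrix.invOf_eq_nonsing_inv, norm_mul]

/-- For a Hermitian matrix the inline negative root count `#{roots z of charpoly | Re z < 0}` is the
number of negative eigenvalues in Mathlib's enumeration. -/
theorem coFactorisation_countP_eq_card {k : Type*} [Fintype k] [DecidableEq k] {M : Matrix k k ℂ}
    (hM : M.IsHermitian) :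
    M.charpoly.roots.countP (fun z => z.re < 0) =
      (Finset.univ.filter fun i => hM.eigenvalues i < 0).card := by
  rw [countP_roots_charpoly_eq_card hM]
  simp only [Complex.ofReal_re]

/-- **Sylvester's law of inertia, one direction, in counting form**: for a Hermitian `N` and a `P` with
a right inverse `Q`, `n₋(N) ≤ n₋(Pᴴ N P)` — the negative eigenspace of `N` (spanned through the
eigenvector unitary), pulled back through `Q`, is a subspace of dimension `n₋(N)` on which the form of
`Pᴴ N P` is negative (congruence bookkeeping `(Q y)† (Pᴴ N P) (Q y) = y† N y`, the landed
`haynsworth_form_congr`, is re-derived inline since its module is not importable here); apply the tree's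
inertia bound `card_le_card_eigenvalues_of_form_pos`. -/
theorem coFactorisation_countP_le_congr {k : Type*} [Fintype k] [DecidableEq k] {N P Q : Matrix k k ℂ}
    (hN : N.IsHermitian) (hPQ : P * Q = 1) :
    N.charpoly.roots.countP (fun z => z.re < 0) ≤
      (Pᴴ * N * P).charpoly.roots.countP (fun z => z.re < 0) := by
  have hM : (Pᴴ * N * P).IsHermitian := isHermitian_conjTranspose_mul_mul P hN
  -- congruence bookkeeping: on `Q y` the form of `Pᴴ N P` is the form of `N` on `y`
  have hcongr : ∀ y : k → ℂ, star (Q *ᵥ y) ⬝ᵥ ((Pᴴ * N * P) *ᵥ (Q *ᵥ y)) = star y ⬝ᵥ (N *ᵥ y) := by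
    intro y
    rw [mulVec_mulVec, Matrix.mul_assoc (Pᴴ * N) P Q, hPQ, Matrix.mul_one, ← mulVec_mulVec,
      dotProduct_mulVec, ← star_mulVec, mulVec_mulVec, hPQ, one_mulVec]
  set U : Matrix k k ℂ := (hN.eigenvectorUnitary : Matrix k k ℂ) with hU
  have hUU : Uᴴ * U = 1 := by
    have := Matrix.mem_unitaryGroup_iff'.1 (hN.eigenvectorUnitary).2
    simpa [Matrix.star_eq_conjTranspose] using this
  rw [coFactorisation_countP_eq_card hN, coFactorisation_countP_eq_card hM, ← Fintype.card_subtype]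
  -- extension by zero from the negative coordinates
  set ext := Function.ExtendByZero.linearMap ℂ (Subtype.val : {i // hN.eigenvalues i < 0} → k) with hext
  have hext_pos : ∀ (c : {i // hN.eigenvalues i < 0} → ℂ) (j : {i // hN.eigenvalues i < 0}),
      ext c j.val = c j := fun c j => by
    rw [hext, Function.ExtendByZero.linearMap_apply, Subtype.val_injective.extend_apply]
  have hext_neg : ∀ (c : {i // hN.eigenvalues i < 0} → ℂ) {i : k}, ¬ hN.eigenvalues i < 0 →
      ext c i = 0 := fun c i hi => by
    rw [hext, Function.ExtendByZero.linearMap_apply,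
      Function.extend_apply' _ _ _ (fun ⟨a, ha⟩ => hi (ha ▸ a.2)), Pi.zero_apply]
  have h := card_le_card_eigenvalues_of_form_pos hM (-1)
    ((Matrix.mulVecLin Q) ∘ₗ (Matrix.mulVecLin U) ∘ₗ ext) (fun c hc => ?_)
  · simpa only [neg_mul, one_mul, Left.neg_pos_iff] using h
  · simp only [LinearMap.coe_comp, Function.comp_apply, Matrix.mulVecLin_apply, neg_mul, one_mul,
      Left.neg_pos_iff]
    rw [hcongr, re_form_eq_sum_eigenvalues hN, ← hU, mulVec_mulVec, hUU, one_mulVec]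
    have hle : ∀ i ∈ Finset.univ, hN.eigenvalues i * ‖ext c i‖ ^ 2 ≤ 0 := by
      intro i _
      by_cases hi : hN.eigenvalues i < 0
      · exact mul_nonpos_of_nonpos_of_nonneg hi.le (by positivity)
      · rw [hext_neg c hi, norm_zero]
        simp
    obtain ⟨j, hj⟩ : ∃ j, c j ≠ 0 := Function.ne_iff.mp hc
    have hxj : ‖ext c j.val‖ = ‖c j‖ := by rw [hext_pos c j]
    have hlt : hN.eigenvalues j.val * ‖ext c j.val‖ ^ 2 < 0 :=
      mul_neg_of_neg_of_pos j.2 (by rw [hxj]; exact pow_pos (norm_pos_iff.mpr hj) 2)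
    have hsum := Finset.sum_lt_sum hle ⟨j.val, Finset.mem_univ _, hlt⟩
    simpa using hsum

/-- **Sylvester's law of inertia in counting form**: congruence by an invertible matrix preserves the
number of negative eigenvalues of a Hermitian matrix, `n₋(Pᴴ N P) = n₋(N)` (`P Q = 1`; the reverse
inequality is the forward one for `Qᴴ (Pᴴ N P) Q = N`). -/
theorem coFactorisation_countP_congr {k : Type*} [Fintype k] [DecidableEq k] {N P Q : Matrix k k ℂ}
    (hN : N.IsHermitian) (hPQ : P * Q = 1) :
    (Pᴴ * N * P).charpoly.roots.countP (fun z => z.re < 0) =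
      N.charpoly.roots.countP (fun z => z.re < 0) := by
  refine le_antisymm ?_ (coFactorisation_countP_le_congr hN hPQ)
  have hQP : Q * P = 1 := mul_eq_one_comm.mp hPQ
  have hM : (Pᴴ * N * P).IsHermitian := isHermitian_conjTranspose_mul_mul P hN
  have h := coFactorisation_countP_le_congr hM hQP
  have hback : Qᴴ * (Pᴴ * N * P) * Q = N := by
    calc Qᴴ * (Pᴴ * N * P) * Q = (P * Q)ᴴ * N * (P * Q) := by
          rw [conjTranspose_mul]
          simp only [Matrix.mul_assoc]
      _ = N := by rw [hPQ, conjTranspose_one, Matrix.one_mul, Matrix.mul_one]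
  rwa [hback] at h

/-- Negative root counts add over a two-block block-diagonal matrix
(`charpoly (S ⊕ D) = charpoly S · charpoly D`, Mathlib `Matrix.charpoly_fromBlocks_zero₁₂`). -/
theorem coFactorisation_countP_fromBlocks_zero {m n : Type*} [Fintype m] [Fintype n] [DecidableEq m]
    [DecidableEq n] (S : Matrix m m ℂ) (D : Matrix n n ℂ) :
    (fromBlocks S 0 0 D).charpoly.roots.countP (fun z => z.re < 0) =
      S.charpoly.roots.countP (fun z => z.re < 0) + D.charpoly.roots.countP (fun z => z.re < 0) := by
  rw [Matrix.charpoly_fromBlocks_zero₁₂,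
    Polynomial.roots_mul (mul_ne_zero (Matrix.charpoly_monic S).ne_zero (Matrix.charpoly_monic D).ne_zero),
    Multiset.countP_add]

/-- **Index half — Haynsworth inertia additivity** for a Hermitian block matrix with invertible Hermitian
corner `D`: `n₋([[A, B], [Bᴴ, D]]) = n₋(D) + n₋(A − B D⁻¹ Bᴴ)` (LDU congruence `H = Pᴴ (S ⊕ D) P`,
Sylvester, block additivity). -/
theorem coFactorisation_countP_fromBlocks {m n : Type*} [Fintype m] [Fintype n] [DecidableEq m]
    [DecidableEq n] (A : Matrix m m ℂ) (B : Matrix m n ℂ) (D : Matrix n n ℂ) (hA : A.IsHermitian)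
    (hD : D.IsHermitian) (hDdet : D.det ≠ 0) :
    (Matrix.fromBlocks A B Bᴴ D).charpoly.roots.countP (fun z => z.re < 0) =
      D.charpoly.roots.countP (fun z => z.re < 0) +
        (A - B * D⁻¹ * Bᴴ).charpoly.roots.countP (fun z => z.re < 0) := by
  have hDu : IsUnit D.det := isUnit_iff_ne_zero.mpr hDdet
  have hDD : D * D⁻¹ = 1 := D.mul_nonsing_inv hDu
  have hDD' : D⁻¹ * D = 1 := D.nonsing_inv_mul hDu
  have hDinv : D⁻¹ᴴ = D⁻¹ := by rw [conjTranspose_nonsing_inv, hD.eq]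
  set S : Matrix m m ℂ := A - B * D⁻¹ * Bᴴ with hS
  set L : Matrix n m ℂ := D⁻¹ * Bᴴ with hL
  set P : Matrix (m ⊕ n) (m ⊕ n) ℂ := fromBlocks 1 0 L 1 with hP
  set Q : Matrix (m ⊕ n) (m ⊕ n) ℂ := fromBlocks 1 0 (-L) 1 with hQ
  set N : Matrix (m ⊕ n) (m ⊕ n) ℂ := fromBlocks S 0 0 D with hN
  -- `P` is block unitriangular, with the explicit inverse `Q`
  have hPQ : P * Q = 1 := by
    rw [hP, hQ, fromBlocks_multiply]
    simp
  -- the LDU congruence `H = Pᴴ N P`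
  have hLH : Lᴴ = B * D⁻¹ := by
    rw [hL, conjTranspose_mul, conjTranspose_conjTranspose, hDinv]
  have h1 : Lᴴ * D = B := by rw [hLH, Matrix.mul_assoc, hDD', Matrix.mul_one]
  have h2 : D * L = Bᴴ := by rw [hL, ← Matrix.mul_assoc, hDD, Matrix.one_mul]
  have h3 : S + B * L = A := by rw [hS, hL, ← Matrix.mul_assoc, sub_add_cancel]
  have hfact : fromBlocks A B Bᴴ D = Pᴴ * N * P := by
    rw [hP, hN, fromBlocks_conjTranspose, fromBlocks_multiply, fromBlocks_multiply]
    simp only [conjTranspose_one, conjTranspose_zero, Matrix.one_mul, Matrix.mul_one, Matrix.mul_zero,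
      Matrix.zero_mul, add_zero, zero_add, h1, h2, h3]
  -- `N = S ⊕ D` is Hermitian
  have hSh : S.IsHermitian := hA.sub (isHermitian_mul_mul_conjTranspose B hD.inv)
  have hNh : N.IsHermitian := Matrix.IsHermitian.fromBlocks hSh (by simp) hD
  -- Sylvester + block additivity
  rw [hfact, coFactorisation_countP_congr hNh hPQ, hN, coFactorisation_countP_fromBlocks_zero, add_comm]

/-- **S3 — co-factorisation of weight and index through one Schur complement.**  For a Hermitian block
matrix `H = [[A, B], [Bᴴ, D]]` with `D` Hermitian and invertible and `S = A − B D⁻¹ Bᴴ`: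
`‖det H‖ = ‖det D‖ · ‖det S‖` (Mathlib `Matrix.det_fromBlocks₂₂`) and `n₋(H) = n₋(D) + n₋(S)` (Haynsworth
inertia additivity: `H = Pᴴ (S ⊕ D) P` with `P` block unitriangular, Sylvester, block additivity). -/
theorem stub_coFactorisation :
    ∀ {m n : Type*} [Fintype m] [Fintype n] [DecidableEq m] [DecidableEq n]
      (A : Matrix m m ℂ) (B : Matrix m n ℂ) (D : Matrix n n ℂ), A.IsHermitian → D.IsHermitian → D.det ≠ 0 →
      ‖(Matrix.fromBlocks A B Bᴴ D).det‖ = ‖D.det‖ * ‖(A - B * D⁻¹ * Bᴴ).det‖ ∧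
        (Matrix.fromBlocks A B Bᴴ D).charpoly.roots.countP (fun z => z.re < 0) =
          D.charpoly.roots.countP (fun z => z.re < 0) +
            (A - B * D⁻¹ * Bᴴ).charpoly.roots.countP (fun z => z.re < 0) := by
  intro m n _ _ _ _ A B D hA hD hDdet
  exact ⟨coFactorisation_norm_det A B D hDdet, coFactorisation_countP_fromBlocks A B D hA hD hDdet⟩

end Summit.QuantumFields.QCD.Cruxes.WindowExtinction.WallConditionedCellSpread
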